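import Literature.Analysis.FunctionSpaces.SpinorWightmanWrongParity
import HarnessLib

/-!
# The PCT condition on the Wightman functions of a spinor theory (Streater–Wightman (4-19))

Topic `Literature/Analysis/FunctionSpaces`. The Wightman-function clause of
`Literature.Analysis.FunctionSpaces.pct_theorem` (Streater–Wightman (1964), §4-3, Thm. 4-7,
eq. (4-19)) in exactly the printed/stated form: for every species sequence `k`, multi-index `α` and
test functions `f`,

`𝒲_{k,α}(f) = i^F ∑_β ∏ⱼ C_{kⱼ}(αⱼ, βⱼ) 𝒲_{k∘rev, β∘rev}(f̂ ∘ rev)`,   `f̂(x) = f(−x)`,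

with `C_k = SL2C.pctMatrix (S k)` and `F` the number of Fermi species in `k`
(`IsSpinorWightmanQFT.wightmanFn_pct`). For even `F` this is `wightmanFn_eq_pct`
(`SpinorWightmanPCTIdentity`) with `(−1)^{F(F−1)/2} = i^F` (`fermiPairSign_eq_I_pow_of_even`); for
odd `F` both sides vanish (`wightmanFn_eq_zero_of_odd`, `SpinorWightmanWrongParity`). The matrices
`C_k` have the three stated properties (`pctMatrix_mul_self`, `commute_pctMatrix`,
`pctMatrix_eq_one_of_eq_one` of `SL2CPCTMatrix`), collected in `IsSpinorWightmanQFT.pct_matrices`.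

## References

* R. F. Streater, A. S. Wightman, *PCT, Spin and Statistics, and All That* (1964; Princeton 2000),
  §4-3 Thm. 4-7 eq. (4-19). [StreaterWightman1964]
-/

noncomputable section

open Filter MeasureTheory Set ComplexConjugate Complex
open _root_.Topology
open scoped InnerProductSpace SchwartzMap MatrixGroups
open Literature.MathematicalPhysics Literature.MathematicalPhysics.QuantumLattice

namespace Literature.Analysis.FunctionSpaces

variable {κ : Type*}

/-- Counting the `true` entries of a tuple. [folklore] -/
theorem count_true_ofFn {n : ℕ} (b : Fin n → Bool) :
    (List.ofFn b).count true = (Finset.univ.filter fun j => b j = true).card := by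
  induction n with
  | zero => simp
  | succ m ih =>
    rw [List.ofFn_succ, List.count_cons, ih (fun j => b j.succ), Finset.card_filter, Finset.card_filter, Fin.sum_univ_succ,
      add_comm]
    congr 1
    simp

/-- The number of Fermi species of the reversed sequence. [folklore] -/
theorem card_filter_rev {n : ℕ} (b : Fin n → Bool) :
    (Finset.univ.filter fun j => b (Fin.rev j) = true).card = (Finset.univ.filter fun j => b j = true).card := by
  rw [← count_true_ofFn, ← count_true_ofFn, ← List.reverse_ofFn', List.count_reverse]

namespace IsSpinorWightmanQFT

open SpinorWightmanData

variable {W : SpinorWightmanData κ}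

/-- **The PCT condition on the Wightman functions** (Streater–Wightman (1964), Thm. 4-7, eq. (4-19)):
`𝒲_{k,α}(f) = i^F ∑_β ∏ⱼ C_{kⱼ}(αⱼ, βⱼ) 𝒲_{k∘rev, β∘rev}(f̂ ∘ rev)` with `C_k = pctMatrix (S k)` and
`F` the number of Fermi species. [cite: StreaterWightman1964, §4-3 Thm 4-7 eq. (4-19)] -/
theorem wightmanFn_pct (hW : IsSpinorWightmanQFT W) (n : ℕ) (k : Fin n → κ) (α : (j : Fin n) → Fin (W.mult (k j)))
    (f : Fin n → 𝓢(SpaceTime 3, ℂ)) :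
    W.wightmanFn n k α f =
      I ^ (Finset.univ.filter fun i => W.isFermi (k i) = true).card *
        ∑ β : (i : Fin n) → Fin (W.mult (k i)), (∏ i, SL2C.pctMatrix (W.S (k i)) (hW.continuous_S (k i)) (α i) (β i)) *
          W.wightmanFn n (fun i => k (Fin.rev i)) (fun i => β (Fin.rev i)) (fun i => reflectTest (f (Fin.rev i))) := by
  rcases Nat.even_or_odd (Finset.univ.filter fun i => W.isFermi (k i) = true).card with heven | hodd
  · rw [hW.wightmanFn_eq_pct k α f, fermiPairSign_eq_I_pow_of_even _ (by rwa [count_true_ofFn]), count_true_ofFn]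
  · rw [hW.wightmanFn_eq_zero_of_odd k α f hodd]
    symm
    refine mul_eq_zero_of_right _ (Finset.sum_eq_zero fun β _ => mul_eq_zero_of_right _ ?_)
    exact hW.wightmanFn_eq_zero_of_odd _ _ _ (by rwa [card_filter_rev (fun i => W.isFermi (k i))])

/-- **The PCT matrices of the species**: `C_k = pctMatrix (S k)` are involutions commuting with
`S k` and trivial for trivial `S k`. [cite: StreaterWightman1964, §4-3 Thm 4-7] -/
theorem pct_matrices (hW : IsSpinorWightmanQFT W) :
    (∀ k, SL2C.pctMatrix (W.S k) (hW.continuous_S k) * SL2C.pctMatrix (W.S k) (hW.continuous_S k) = 1) ∧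
    (∀ k A, SL2C.pctMatrix (W.S k) (hW.continuous_S k) * W.S k A = W.S k A * SL2C.pctMatrix (W.S k) (hW.continuous_S k)) ∧
    (∀ k, W.S k = 1 → SL2C.pctMatrix (W.S k) (hW.continuous_S k) = 1) :=
  ⟨fun k => SL2C.pctMatrix_mul_self (W.S k) (hW.continuous_S k),
    fun k A => (SL2C.commute_pctMatrix (W.S k) (hW.continuous_S k) A).eq,
    fun k h => SL2C.pctMatrix_eq_one_of_eq_one (W.S k) (hW.continuous_S k) h⟩

end IsSpinorWightmanQFT

end Literature.Analysis.FunctionSpaces
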